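import Summits.HodgeConjecture.CorCM.GaloisCyclicSemidirectEightDegenerate
import Mathlib.GroupTheory.SpecificGroups.Dihedral
import HarnessLib

/-!
# Doubled CM types in a SPLIT extension by an involution: `G = i(A) ⊔ i(A)·x` with `x² = 1` — `D₄ × C_n` is BAD

COR-CM (cell `pub-hodgecm2`), binder seat b04 (gen 29), count-neutral claim SPLIT-INVOLUTION (generalises gen 22's mirror types
for generalised dihedral groups `Dih(A) = A ⋊₋₁ C₂`, `CorCM/GaloisDihedralGeneralisedMirrorTypes`, from inversion to an
ARBITRARY involutive automorphism `θ`).  KERNEL ONLY: theorems; no definition, no named fact, no `sorry`.  `HC_CM` is neither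
used nor claimed.

SETTING (gen 20's two-sheet frame `CorCM/TwoSheetAnnihilator`).  `i : A ↪ G₀` an abelian subgroup of index two,
`G₀ = i(A) ⊔ i(A)x`, `x i(u) x⁻¹ = i(θ u)`, complex conjugation `c₀ = i(c)`, `c ∈ A`, `c² = 1`, `θ c = c` — and the extension
SPLITS: `x² = 1`.  For a CM half `S ⊆ A` (`a ∈ S ↔ c a ∉ S`) the DOUBLED TYPE is `T = i(S) ⊔ i(S)·x` (both sheets equal to
`S`).  Its two-sheet determinant at ANY odd character `χ` is `Ŝ(χ)Ŝ(χθ) − χ(x²)·Ŝ(χ)Ŝ(χθ) = 0` since `x² = 1`: EVERY odd block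
is singular, so (gen 28 `TwoSheet.exists_annihilator_of_det_eq_zero`) `T` carries a non-zero antisymmetric annihilator; and the
left stabiliser of `T` is trivial iff `S` is APERIODIC (`aS ≠ S`, `a ≠ 1`) and `θ`-ASYMMETRIC (`a·θ(S) ≠ S` for all `a`).  For
`θ = inversion` this is gen 22's mirror type; the point of this file is that NOTHING about `θ` is needed.

* §1 `doubled_mem_iff`, `doubled_cm`, `doubled_leftStabiliser`, **`exists_annihilator_of_doubled`** (model level).
* §2 **`exists_simple_degenerate_of_split_involution`**: for a Galois CM field `K` with `e : Gal(K/ℚ) ≃* G₀`, `e(conj) = i(c)`,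
  an aperiodic `θ`-asymmetric CM half of `A` gives a PRIMITIVE DEGENERATE CM type of `K`, realised by a SIMPLE abelian variety of
  dimension `|G₀|/2` with a rational `(q,q)` class outside the divisor ring on some power.
* §3 **`D₄ × C_n` (`c₀ = (r², 1)`) is BAD for EVERY `n ≥ 3`** — the first infinite row of the «exceptional real factor `C_p`»
  table of gen 24 (`GaloisRealFactorDegenerate` excludes exactly the real factors `H ∈ {1, C₂, C₂², C₂³, C₄, C_p, S₃}`): here
  `A = ℤ/4 × ℤ/n`, `x = (sr 0, 1)`, `θ(t, v) = (−t, v)`, and the half `S = {(t, v) : t ∈ {k(v), k(v)+1}}` with `k = 𝟙_{v = 1}`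
  is aperiodic and `θ`-asymmetric as soon as `n ≥ 3` (`exists_simple_degenerate_dihedralFour_cyclic`; instances `n = 5, 7, 9`
  of orders `40, 56, 72`).  Contrast: `Q₈ × C_p` (`x² = c₀`, NON-split) is the arithmetic family of `CorCM/GaloisQuaternionCyclic*`.

## References

* [Kubota1965] T. Kubota, *On the field extension by complex multiplication*, Trans. AMS 118 (1965), §2, §4 Lemma 2.
* [Shimura1998] G. Shimura, *Abelian Varieties with Complex Multiplication and Modular Functions*, §6.2 Thm. 3, §8.2 Prop. 26.
* [Gordon1999HodgeAVSurvey] B. B. Gordon, *A survey of the Hodge conjecture for abelian varieties*, Thm. 6.4, §9.3.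
-/

noncomputable section

open CategoryTheory CategoryTheory.Limits NumberField
open scoped BigOperators

namespace Summit.HodgeConjecture.CorCM.SplitInvolution

open Literature.NumberTheory.ComplexMultiplication
open Literature.AlgebraicGeometry.Motives (AbelianVariety CMType)
open Literature.AlgebraicGeometry.HodgeTheory
open Literature.AlgebraicGeometry.ComplexMultiplication (IsCMTypeRealisation)
open Literature.AlgebraicGeometry.Pohlmann1968
open Literature.Barriers.HodgeConjecture (divisorClassesSpan)
open Summit.HodgeConjecture.CorCM.GaloisRank
open Summit.HodgeConjecture.CorCM.AbelianSixteen (exists_simple_realisation_of_isPrimitive)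
open AddChar

/-! ## §1 The doubled type on the model -/

section Model

variable {G₀ : Type*} [Group G₀] [DecidableEq G₀]
variable {A : Type*} [CommGroup A] [Fintype A] [DecidableEq A]

omit [Fintype A] [DecidableEq A] in
/-- Membership in the doubled type `T = i(S) ⊔ i(S)x`: `i u ∈ T ↔ u ∈ S` and `i(u) x ∈ T ↔ u ∈ S`. [folklore] -/
theorem doubled_mem_iff (i : A →* G₀) (hi : Function.Injective i) (x : G₀) (hx : ∀ u, i u ≠ x) (S : Finset A) (u : A) :
    (i u ∈ S.image i ∪ S.image (fun s => i s * x) ↔ u ∈ S) ∧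
      (i u * x ∈ S.image i ∪ S.image (fun s => i s * x) ↔ u ∈ S) := by
  have hx' : ∀ u v : A, i u ≠ i v * x := fun u v h => hx (v⁻¹ * u) (by rw [map_mul, map_inv, h]; group)
  constructor
  · rw [Finset.mem_union, Finset.mem_image, Finset.mem_image]
    constructor
    · rintro (⟨s, hs, hsu⟩ | ⟨s, -, hsu⟩)
      · rwa [← hi hsu]
      · exact absurd hsu.symm (hx' u s)
    · exact fun hu => Or.inl ⟨u, hu, rfl⟩
  · rw [Finset.mem_union, Finset.mem_image, Finset.mem_image]
    constructor
    · rintro (⟨s, -, hsu⟩ | ⟨s, hs, hsu⟩)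
      · exact absurd hsu (hx' s u)
      · rwa [← hi (mul_right_cancel hsu)]
    · exact fun hu => Or.inr ⟨u, hu, rfl⟩

omit [Fintype A] [DecidableEq A] in
/-- The doubled type is a CM set for `c₀ = i(c)` when `S` is a CM half for `c`. [folklore] -/
theorem doubled_cm (i : A →* G₀) (hi : Function.Injective i) (x : G₀) (hx : ∀ u, i u ≠ x)
    (hcov : ∀ g : G₀, (∃ u, g = i u) ∨ (∃ u, g = i u * x)) {c : A} (S : Finset A) (hS : ∀ a, a ∈ S ↔ c * a ∉ S)
    (g : G₀) : g ∈ S.image i ∪ S.image (fun s => i s * x) ↔ i c * g ∉ S.image i ∪ S.image (fun s => i s * x) := by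
  have hmem := doubled_mem_iff i hi x hx S
  rcases hcov g with ⟨u, rfl⟩ | ⟨u, rfl⟩
  · rw [(hmem u).1, ← map_mul, (hmem (c * u)).1, hS u]
  · rw [(hmem u).2, ← mul_assoc, ← map_mul, (hmem (c * u)).2, hS u]

omit [Fintype A] [DecidableEq A] in
/-- **Trivial left stabiliser**: if `S` is aperiodic (`aS ≠ S` for `a ≠ 1`) and `θ`-asymmetric (`a·θ(S) ≠ S` for all `a`),
no `v ≠ 1` of `G₀` stabilises the doubled type. [folklore] -/
theorem doubled_leftStabiliser (i : A →* G₀) (hi : Function.Injective i) (x : G₀) (hx : ∀ u, i u ≠ x)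
    (hcov : ∀ g : G₀, (∃ u, g = i u) ∨ (∃ u, g = i u * x)) (θ : A ≃* A) (hθ : ∀ u, x * i u = i (θ u) * x)
    (S : Finset A) (haper : ∀ a : A, a ≠ 1 → ∃ s, ¬ (s ∈ S ↔ a * s ∈ S))
    (hasym : ∀ a : A, ∃ s, ¬ (s ∈ S ↔ a * θ s ∈ S)) (v : G₀) (hv : v ≠ 1) :
    ∃ w, ¬ (w ∈ S.image i ∪ S.image (fun s => i s * x) ↔ v * w ∈ S.image i ∪ S.image (fun s => i s * x)) := by
  have hmem := doubled_mem_iff i hi x hx S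
  rcases hcov v with ⟨a, rfl⟩ | ⟨a, rfl⟩
  · have ha : a ≠ 1 := fun h => hv (by rw [h, map_one])
    obtain ⟨s, hs⟩ := haper a ha
    refine ⟨i s, ?_⟩
    rwa [(hmem s).1, ← map_mul, (hmem (a * s)).1]
  · obtain ⟨s, hs⟩ := hasym a
    refine ⟨i s, ?_⟩
    rwa [(hmem s).1, mul_assoc, hθ, ← mul_assoc, ← map_mul, (hmem (a * θ s)).2]

omit [DecidableEq A] in
/-- An abelian group with an element `c ≠ 1`, `c² = 1`, has an ODD character (`χ(c) = −1`): `Σ_χ χ(c) = 0`. [folklore] -/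
theorem exists_odd_character {c : A} (hc1 : c ≠ 1) (hcc : c * c = 1) :
    ∃ χ : AddChar (Additive A) ℂ, χ (Additive.ofMul c) = -1 := by
  classical
  by_contra hall
  push Not at hall
  have hone : ∀ χ : AddChar (Additive A) ℂ, χ (Additive.ofMul c) = 1 := fun χ =>
    (TwoSheet.character_involution χ hcc).resolve_right (hall χ)
  have hc0 : Additive.ofMul c ≠ 0 := fun h => hc1 (by simpa using congrArg Additive.toMul h)
  have hsum : ∑ χ : AddChar (Additive A) ℂ, χ (Additive.ofMul c) = 0 := AddChar.sum_apply_eq_zero_iff_ne_zero.2 hc0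
  simp only [hone, Finset.sum_const, Finset.card_univ, nsmul_eq_mul, mul_one] at hsum
  exact Nat.cast_ne_zero.2 Fintype.card_ne_zero hsum

omit [DecidableEq A] in
/-- **EVERY ODD BLOCK OF A DOUBLED TYPE IS SINGULAR, hence a non-zero rational annihilator** (`x² = 1`: the two-sheet
determinant at an odd `χ` is `Ŝ(χ)Ŝ(χθ) − χ(1)·Ŝ(χ)Ŝ(χθ) = 0`; gen 28 `TwoSheet.exists_annihilator_of_det_eq_zero`).
[cite: Kubota1965, §4 Lemma 2] -/
theorem exists_annihilator_of_doubled [Fintype G₀] (i : A →* G₀) (hi : Function.Injective i) (x : G₀) (hx : ∀ u, i u ≠ x)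
    (hcov : ∀ g : G₀, (∃ u, g = i u) ∨ (∃ u, g = i u * x)) (θ : A ≃* A) (hθ : ∀ u, x * i u = i (θ u) * x)
    (hxx : x * x = 1) {c : A} (hc1 : c ≠ 1) (hcc : c * c = 1) (hθc : θ c = c) (S : Finset A) :
    ∃ b : G₀ → ℚ, b ≠ 0 ∧ (∀ g, b (i c * g) = -b g) ∧
      ∀ g : G₀, ∑ s ∈ S.image i ∪ S.image (fun s => i s * x), b (s * g) = 0 := by
  classical
  obtain ⟨χ, hχ⟩ := exists_odd_character hc1 hcc
  have hmem := doubled_mem_iff i hi x hx S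
  exact TwoSheet.exists_annihilator_of_det_eq_zero i hi x hx hcov θ hθ 1 (by rw [hxx, map_one]) hθc
    (S.image i ∪ S.image (fun s => i s * x)) S S (fun u => ((hmem u).1).symm) (fun u => ((hmem u).2).symm) χ hχ
    (by rw [ofMul_one, map_zero_eq_one, one_mul, sub_self])

end Model

/-! ## §2 The Galois dress -/

section Field

variable {G₀ : Type*} [Group G₀] [Fintype G₀] [DecidableEq G₀]
variable {A : Type*} [CommGroup A] [Fintype A]
variable {K : Type} [Field K] [NumberField K] [IsCMField K] [IsGalois ℚ K]

/-- **SPLIT INVOLUTION ⟹ BAD.**  `K` a Galois CM field, `e : Gal(K/ℚ) ≃* G₀`, `i : A ↪ G₀` abelian of index two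
(`G₀ = i(A) ⊔ i(A)x`), `x i(u) = i(θ u) x`, `x² = 1`, complex conjugation `e(c̄) = i(c)` with `c ≠ 1`, `c² = 1`, `θ c = c`.  If
`A` has a CM half `S` (`a ∈ S ↔ ca ∉ S`) which is APERIODIC and `θ`-ASYMMETRIC, then `K` has a PRIMITIVE DEGENERATE CM type —
realised by a SIMPLE abelian variety of dimension `|G₀|/2` with CM by `K` carrying a rational `(q,q)` class outside the divisor
ring on some power. [cite: Kubota1965, §2 and §4 Lemma 2] [cite: Shimura1998, §6.2 Thm. 3 and §8.2 Prop. 26]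
[cite: Gordon1999HodgeAVSurvey, Thm. 6.4 and §9.3] -/
theorem exists_simple_degenerate_of_split_involution (e : (K ≃ₐ[ℚ] K) ≃* G₀) (i : A →* G₀) (hi : Function.Injective i)
    (x : G₀) (hx : ∀ u, i u ≠ x) (hcov : ∀ g : G₀, (∃ u, g = i u) ∨ (∃ u, g = i u * x)) (θ : A ≃* A)
    (hθ : ∀ u, x * i u = i (θ u) * x) (hxx : x * x = 1) {c : A} (hc1 : c ≠ 1) (hcc : c * c = 1) (hθc : θ c = c)
    (hc : e ((IsCMField.complexConj K).restrictScalars ℚ) = i c) (S : Finset A) (hS : ∀ a, a ∈ S ↔ c * a ∉ S)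
    (haper : ∀ a : A, a ≠ 1 → ∃ s, ¬ (s ∈ S ↔ a * s ∈ S)) (hasym : ∀ a : A, ∃ s, ¬ (s ∈ S ↔ a * θ s ∈ S)) :
    ∃ (Φ : CMType K) (φ₀ : K →+* ℂ) (X : AbelianVariety ℂ) (ι : 𝓞 K →+* End X)
      (ϑ : K →+* Module.End ℂ (complexBetti X.X 1)),
      IsPrimitive (ℂ ≃+* ℂ) Φ.1 φ₀ ∧ ¬ IsNondegenerate Φ ∧ IsCMTypeRealisation Φ X ι ϑ ∧ X.IsSimple ∧
      X.dim = Fintype.card G₀ / 2 ∧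
      ∃ n q : ℕ, ∃ y : complexBetti (⨁ fun _ : Fin n => X).X (2 * q), IsRationalClass y ∧
        IsOfHodgeType (⨁ fun _ : Fin n => X).dim (⨁ fun _ : Fin n => X).X (2 * q) q q y ∧
        y ∉ divisorClassesSpan (⨁ fun _ : Fin n => X).X (⨁ fun _ : Fin n => X).dim q := by
  classical
  set T : Finset G₀ := S.image i ∪ S.image (fun s => i s * x) with hT_def
  have hcm : ∀ g, g ∈ T ↔ i c * g ∉ T := doubled_cm i hi x hx hcov S hS
  have hprim : ∀ v : G₀, v ≠ 1 → ∃ w, ¬ (w ∈ T ↔ v * w ∈ T) := doubled_leftStabiliser i hi x hx hcov θ hθ S haper hasym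
  obtain ⟨φ₀⟩ := (inferInstance : Nonempty (K →+* ℂ))
  obtain ⟨Φ, hprimΦ, hread⟩ := GaloisTable.exists_isPrimitive_of_tableModel (K := K) (X := G₀)
    (fun a b => a * b) e.toEquiv (fun _ _ => map_mul e _ _) (i c) hc 1 (map_one e) T hcm hprim φ₀
  have hread' : ∀ y, y ∈ T ↔ embOf φ₀ (e.symm y) ∈ Φ.1 := fun y => hread y
  obtain ⟨b, hb0, hb, hbann⟩ := exists_annihilator_of_doubled i hi x hx hcov θ hθ hxx hc1 hcc hθc S
  have hdeg : ¬ IsNondegenerate Φ := fun hnd =>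
    hb0 ((isNondegenerate_iff_forall_annihilator e hc Φ φ₀ T hread').1 hnd b hb hbann)
  obtain ⟨X, ι, ϑ, hX, hs, hdim⟩ := exists_simple_realisation_of_isPrimitive Φ φ₀ hprimΦ
  refine ⟨Φ, φ₀, X, ι, ϑ, hprimΦ, hdeg, hX, hs, ?_, exists_exceptional_pow_of_not_isNondegenerate φ₀ hprimΦ hdeg hX⟩
  rw [hdim, ← card_model_eq_finrank e]

end Field

/-! ## §3 `D₄ × C_n`: the split involution `x = (sr 0, 1)`; instances `n = 5, 7` -/

section DihedralFour

variable {K : Type} [Field K] [NumberField K] [IsCMField K] [IsGalois ℚ K]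

/-- **`Gal(K/ℚ) ≅ D₄ × C_n` (complex conjugation `(r², 1)`) with an aperiodic `θ`-asymmetric half of `ℤ/4 × ℤ/n` is BAD**:
`A = ⟨r⟩ × C_n ≅ ℤ/4 × ℤ/n ↪ D₄ × C_n`, `x = (sr 0, 1)`, `x² = 1`, `θ(t, v) = (−t, v)`, `c = (2, 0)`; a simple DEGENERATE abelian
variety of dimension `4n` with CM by `K`.  (For `n = 1` no such half exists — `D₄` is GOOD; for `n ≥ 3` the graph pair of
`k = 𝟙_{v=1}` is one, instances below.) [cite: Kubota1965, §2 and §4 Lemma 2] [cite: Shimura1998, §6.2 Thm. 3 and §8.2 Prop. 26]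
[cite: Gordon1999HodgeAVSurvey, Thm. 6.4 and §9.3] -/
theorem exists_simple_degenerate_dihedralFour_cyclic_of_half {n : ℕ} [NeZero n]
    (e : (K ≃ₐ[ℚ] K) ≃* DihedralGroup 4 × Multiplicative (ZMod n))
    (hc : e ((IsCMField.complexConj K).restrictScalars ℚ) = (DihedralGroup.r 2, 1))
    (P : ZMod 4 × ZMod n → Prop) [DecidablePred P] (hP : ∀ s, P s ↔ ¬ P ((2, 0) + s))
    (haper : ∀ a : ZMod 4 × ZMod n, a ≠ 0 → ∃ s, ¬ (P s ↔ P (a + s)))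
    (hasym : ∀ a : ZMod 4 × ZMod n, ∃ s, ¬ (P s ↔ P (a + (-s.1, s.2)))) :
    ∃ (Φ : CMType K) (φ₀ : K →+* ℂ) (X : AbelianVariety ℂ) (ι : 𝓞 K →+* End X)
      (ϑ : K →+* Module.End ℂ (complexBetti X.X 1)),
      IsPrimitive (ℂ ≃+* ℂ) Φ.1 φ₀ ∧ ¬ IsNondegenerate Φ ∧ IsCMTypeRealisation Φ X ι ϑ ∧ X.IsSimple ∧ X.dim = 4 * n ∧
      ∃ m q : ℕ, ∃ y : complexBetti (⨁ fun _ : Fin m => X).X (2 * q), IsRationalClass y ∧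
        IsOfHodgeType (⨁ fun _ : Fin m => X).dim (⨁ fun _ : Fin m => X).X (2 * q) q q y ∧
        y ∉ divisorClassesSpan (⨁ fun _ : Fin m => X).X (⨁ fun _ : Fin m => X).dim q := by
  classical
  let i₁ : Multiplicative (ZMod 4) →* DihedralGroup 4 :=
    MonoidHom.mk' (fun u => DihedralGroup.r (Multiplicative.toAdd u)) fun u v => by simp [toAdd_mul]
  let i : Multiplicative (ZMod 4) × Multiplicative (ZMod n) →* DihedralGroup 4 × Multiplicative (ZMod n) :=
    MonoidHom.prodMap i₁ (MonoidHom.id _)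
  have hi_apply : ∀ u v, i (u, v) = (DihedralGroup.r (Multiplicative.toAdd u), v) := fun u v => rfl
  have hi : Function.Injective i := by
    rintro ⟨u, v⟩ ⟨u', v'⟩ h
    simp only [hi_apply, Prod.mk.injEq, DihedralGroup.r.injEq] at h
    exact Prod.ext (by simpa using h.1) h.2
  set x : DihedralGroup 4 × Multiplicative (ZMod n) := (DihedralGroup.sr 0, 1) with hx_def
  have hx : ∀ w, i w ≠ x := fun ⟨u, v⟩ => by simp [hi_apply, hx_def]
  have hcov : ∀ g : DihedralGroup 4 × Multiplicative (ZMod n), (∃ w, g = i w) ∨ (∃ w, g = i w * x) := by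
    rintro ⟨j | j, v⟩
    · exact Or.inl ⟨(Multiplicative.ofAdd j, v), by simp [hi_apply]⟩
    · exact Or.inr ⟨(Multiplicative.ofAdd (-j), v), by simp [hi_apply, hx_def]⟩
  let θ : Multiplicative (ZMod 4) × Multiplicative (ZMod n) ≃* Multiplicative (ZMod 4) × Multiplicative (ZMod n) :=
    MulEquiv.prodCongr (MulEquiv.inv _) (MulEquiv.refl _)
  have hθ_apply : ∀ w, θ w = (w.1⁻¹, w.2) := fun w => rfl
  have hθ : ∀ w, x * i w = i (θ w) * x := fun ⟨u, v⟩ => by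
    simp [hi_apply, hθ_apply, hx_def]
  have hxx : x * x = 1 := by simp [hx_def]
  set c : Multiplicative (ZMod 4) × Multiplicative (ZMod n) := (Multiplicative.ofAdd 2, 1) with hc_def
  have hic : i c = (DihedralGroup.r 2, 1) := rfl
  have hc1 : c ≠ 1 := by
    rw [hc_def, Ne, Prod.mk_eq_one, not_and_or]
    exact Or.inl (by decide)
  have h22 : (2 : ZMod 4) + 2 = 0 := by decide
  have hcc : c * c = 1 := by rw [hc_def, Prod.mk_mul_mk, mul_one, ← ofAdd_add, h22]; rfl
  have hθc : θ c = c := by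
    rw [hθ_apply, hc_def]; refine Prod.ext ?_ rfl
    change Multiplicative.ofAdd (-(2 : ZMod 4)) = Multiplicative.ofAdd 2
    rw [neg_eq_of_add_eq_zero_left h22]
  -- the half, read multiplicatively
  set S : Finset (Multiplicative (ZMod 4) × Multiplicative (ZMod n)) :=
    Finset.univ.filter fun w => P (Multiplicative.toAdd w.1, Multiplicative.toAdd w.2) with hS_def
  have hSmem : ∀ w : Multiplicative (ZMod 4) × Multiplicative (ZMod n),
      w ∈ S ↔ P (Multiplicative.toAdd w.1, Multiplicative.toAdd w.2) := fun w => by simp [hS_def]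
  have hS : ∀ a, a ∈ S ↔ c * a ∉ S := fun a => by
    rw [hSmem, hSmem, hc_def, Prod.fst_mul, Prod.snd_mul, one_mul, toAdd_mul, toAdd_ofAdd, hP]
    simp only [Prod.mk_add_mk, zero_add]
  have haper' : ∀ a : Multiplicative (ZMod 4) × Multiplicative (ZMod n), a ≠ 1 → ∃ s, ¬ (s ∈ S ↔ a * s ∈ S) := by
    intro a ha
    have ha' : (Multiplicative.toAdd a.1, Multiplicative.toAdd a.2) ≠ (0 : ZMod 4 × ZMod n) := by
      intro h
      apply ha
      rw [Prod.mk_eq_zero] at h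
      exact Prod.ext (toAdd_eq_zero.1 h.1) (toAdd_eq_zero.1 h.2)
    obtain ⟨⟨s₁, s₂⟩, hs⟩ := haper _ ha'
    refine ⟨(Multiplicative.ofAdd s₁, Multiplicative.ofAdd s₂), ?_⟩
    simpa only [hSmem, Prod.fst_mul, Prod.snd_mul, toAdd_mul, toAdd_ofAdd, Prod.mk_add_mk] using hs
  have hasym' : ∀ a : Multiplicative (ZMod 4) × Multiplicative (ZMod n), ∃ s, ¬ (s ∈ S ↔ a * θ s ∈ S) := by
    intro a
    obtain ⟨⟨s₁, s₂⟩, hs⟩ := hasym (Multiplicative.toAdd a.1, Multiplicative.toAdd a.2)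
    refine ⟨(Multiplicative.ofAdd s₁, Multiplicative.ofAdd s₂), ?_⟩
    simpa only [hSmem, hθ_apply, Prod.fst_mul, Prod.snd_mul, toAdd_mul, toAdd_ofAdd, toAdd_inv, Prod.mk_add_mk] using hs
  obtain ⟨Φ, φ₀, X, ι, ϑ, h1, h2, h3, h4, h5, h6⟩ := exists_simple_degenerate_of_split_involution e i hi x hx hcov θ hθ hxx hc1
    hcc hθc (by rw [hic]; exact hc) S hS haper' hasym'
  refine ⟨Φ, φ₀, X, ι, ϑ, h1, h2, h3, h4, ?_, h6⟩
  rw [h5, Fintype.card_prod, Fintype.card_multiplicative, ZMod.card, DihedralGroup.card]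
  omega

/-- **`D₄ × C₅` (order 40, complex conjugation `(r², 1)`) is BAD**: the graph pair of `k = 𝟙_{v=1}` is an aperiodic
`θ`-asymmetric half — a simple DEGENERATE CM abelian 20-fold with an exceptional class on a power; first row `Γ = D₄` of the
«exceptional real factor `C_p`» table. [cite: Shimura1998, §6.2 Thm. 3 and §8.2 Prop. 26] [cite: Gordon1999HodgeAVSurvey, Thm. 6.4 and §9.3] -/
theorem exists_simple_degenerate_dihedralFour_cyclicFive
    (e : (K ≃ₐ[ℚ] K) ≃* DihedralGroup 4 × Multiplicative (ZMod 5))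
    (hc : e ((IsCMField.complexConj K).restrictScalars ℚ) = (DihedralGroup.r 2, 1)) :
    ∃ (Φ : CMType K) (φ₀ : K →+* ℂ) (X : AbelianVariety ℂ) (ι : 𝓞 K →+* End X)
      (ϑ : K →+* Module.End ℂ (complexBetti X.X 1)),
      IsPrimitive (ℂ ≃+* ℂ) Φ.1 φ₀ ∧ ¬ IsNondegenerate Φ ∧ IsCMTypeRealisation Φ X ι ϑ ∧ X.IsSimple ∧ X.dim = 20 ∧
      ∃ m q : ℕ, ∃ y : complexBetti (⨁ fun _ : Fin m => X).X (2 * q), IsRationalClass y ∧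
        IsOfHodgeType (⨁ fun _ : Fin m => X).dim (⨁ fun _ : Fin m => X).X (2 * q) q q y ∧
        y ∉ divisorClassesSpan (⨁ fun _ : Fin m => X).X (⨁ fun _ : Fin m => X).dim q :=
  exists_simple_degenerate_dihedralFour_cyclic_of_half e hc
    (fun s => s.1 = (if s.2 = 1 then 1 else 0) ∨ s.1 = (if s.2 = 1 then 1 else 0) + 1)
    (by decide) (by decide) (by decide)

/-- **`D₄ × C₇` (order 56, complex conjugation `(r², 1)`) is BAD** (same half; a simple DEGENERATE CM abelian 28-fold).
[cite: Shimura1998, §6.2 Thm. 3 and §8.2 Prop. 26] [cite: Gordon1999HodgeAVSurvey, Thm. 6.4 and §9.3] -/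
theorem exists_simple_degenerate_dihedralFour_cyclicSeven
    (e : (K ≃ₐ[ℚ] K) ≃* DihedralGroup 4 × Multiplicative (ZMod 7))
    (hc : e ((IsCMField.complexConj K).restrictScalars ℚ) = (DihedralGroup.r 2, 1)) :
    ∃ (Φ : CMType K) (φ₀ : K →+* ℂ) (X : AbelianVariety ℂ) (ι : 𝓞 K →+* End X)
      (ϑ : K →+* Module.End ℂ (complexBetti X.X 1)),
      IsPrimitive (ℂ ≃+* ℂ) Φ.1 φ₀ ∧ ¬ IsNondegenerate Φ ∧ IsCMTypeRealisation Φ X ι ϑ ∧ X.IsSimple ∧ X.dim = 28 ∧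
      ∃ m q : ℕ, ∃ y : complexBetti (⨁ fun _ : Fin m => X).X (2 * q), IsRationalClass y ∧
        IsOfHodgeType (⨁ fun _ : Fin m => X).dim (⨁ fun _ : Fin m => X).X (2 * q) q q y ∧
        y ∉ divisorClassesSpan (⨁ fun _ : Fin m => X).X (⨁ fun _ : Fin m => X).dim q :=
  exists_simple_degenerate_dihedralFour_cyclic_of_half e hc
    (fun s => s.1 = (if s.2 = 1 then 1 else 0) ∨ s.1 = (if s.2 = 1 then 1 else 0) + 1)
    (by decide) (by decide) (by decide)

end DihedralFour

end Summit.HodgeConjecture.CorCM.SplitInvolution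

end
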